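/- Copyright: the b2b-balaban cell (near-miss cell 7), T⁴-continuum fan-out, row NE7b, leaf prover `t4-ne7b-formalise-leaf-03` (gen 126) for
the OWNER lineage `t4-ne7b-p1` — INTERFACE REQUEST NE7b IR-101-2 (owner g101 CLOSE, journal l.49019), part 2 of 2: the road.  Released under the
licence of the surrounding project. -/
import Summits.QuantumFields.BalabanUV.T4Continuum.Support.B16HistoryTowerStepDataLWR

/-!
# (α)-INSTANCE — THE END AT THE TOWER, ROUNDED, IN PRINT's PER-STEP SHAPE, part 2: `toTowerR` (the rounded tower record from the
per-step record, by 3R and part 3) and the terminal theorem `continuumYM4Torus_of_towerStepDisplays_fsc` := 2R ∘ `toTowerR`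

Summits-side support leaf of the T⁴-continuum cell (rung (B)+1 on a FINITE torus only; NOT infinite volume, NOT the mass gap, NOT
Clay; NOT a proof of NE7b — the cell's OWN estimate `T4WeightBudget.RelWeightBound`, NOT PRINTED, NOT PROVED).  [folklore] one
record-valued `def`, two `rfl` lemmas (`toTowerR_data`, `toTowerR_Φf`), one theorem; no `[cite:]` tag, no `Prop` minted, zero `sorry`.  INTERFACE REQUEST NE7b IR-101-2
(OWNER `t4-ne7b-p1` g101, CLOSE l.49019), second half: «`toTowerR` := 3R's `hw_of_stepDisplays_rounded` + `hsB_of_tables`;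
`continuumYM4Torus_of_towerStepDisplays_fsc` := 2R ∘ `toTowerR`».

WHAT.  §1 `TowerStepDataLWR.toTowerR : TowerReadDataLWR …` — EVERY field of 1R's record BY NAME from the per-step record (structure
instance `{ Sd with … }`, no copy), except the three slots the per-step record does not have: `sB := B16HistoryStepJunction.sBsharp
(runsOf D g₀) Sd.c` (print's sharp birth letter), `hw := B16HistoryTowerEndPrintedR.hw_of_stepDisplays_rounded …` (3R: J4 + J4.1 at
the rounded renewal letter, fed `Sd.hdisp Sd.hclass Sd.hchain Sd.hd Sd.hR Sd.hP` and the record's own sign rows `hcΛ hMΛ hℓ`), `hsB :=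
B16HistoryTowerEndPrinted.hsB_of_tables …` (part 3, fed `Sd.hγc Sd.hAc Sd.hpc Sd.hγ₀.le Sd.hmc`); `toTowerR_data` (seven `rfl`).  §2
`continuumYM4Torus_of_towerStepDisplays_fsc` = 2R's `continuumYM4Torus_of_towerReadingLWR_fsc` with the `Nonempty` payload
`TowerStepDataLWR …` (same ten window letters `cΛ M Φ b₀ p₁ η η′ κ κ₂ κᵥ`, same conclusion), proof `2R ∘ ForSmallCouplings.mono ∘
toTowerR`.  NET, HONEST: a consumer holding (A1c)'s tower AND print's per-step sentences at its carriers (plus the class junction, the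
volume chain and the letter tables) gets the headline predicate with no lemma application of its own; the displayed inputs are exactly
part 1's fields; nothing of Bałaban's is asserted, valued or discharged; NE7b NOT proved; count 0∕9.  HONEST DEPENDENCY (cell): continuum
YM on T⁴ ⇐ BetaPertH ∧ nine spine estimates (0/9 proved); BetaPertH ⇐ (D1) ∧ (D4) ∧ CAP+tail; G-an2-4 gates asym, D1 and NE2/3/4.
Unchanged here.
-/

open Finset MeasureTheory
open Literature.MathematicalPhysics.QuantumFieldTheory.Balaban1983to89
open T4PersistenceDictionary T4PersistentHistoryCount T4BankedInduction T4PrintedShapeBanking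
open T4WeightBudget T4GlobalDenominator T4LiveClassFibration T4LiveStructureGas T4LiveGasToTerms T4RecordPriceSeam
open T4PartnerMultiplicity T4IndicatorShell T4MatchingAssembly T4MatchingClosure T4MatchingClosureSocket T4Continuum
open T4StabilitySocket T4BranchingRecordsGas T4TaggedShapeBanking T4CanonicalMenus T4RenewalChains
open Summit.QuantumFields.BalabanUV.T4Continuum.PlacementBatch Summit.QuantumFields.BalabanUV.T4Continuum.PlacementSkeleton
open Summit.QuantumFields.BalabanUV.T4Continuum.CountThresholdUniform Summit.QuantumFields.BalabanUV.T4Continuum.CountThresholdExit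
open Summit.QuantumFields.BalabanUV.T4Continuum.CountSeamJunction Summit.QuantumFields.BalabanUV.T4Continuum.LateMergers
open Summit.QuantumFields.BalabanUV.T4Continuum.HistoryFlow Summit.QuantumFields.BalabanUV.T4Continuum.HistoryRegeneration
open Summit.QuantumFields.BalabanUV.T4Continuum.HistoryTables Summit.QuantumFields.BalabanUV.T4Continuum.HistoryAssemblyTrees
open Summit.QuantumFields.BalabanUV.T4Continuum.HistoryAssemblyTerms Summit.QuantumFields.BalabanUV.T4Continuum.HistoryAssemblyPedigree
open Summit.QuantumFields.BalabanUV.T4Continuum.HistoryConstants Summit.QuantumFields.BalabanUV.T4Continuum.HistoryGen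
open Literature.MathematicalPhysics.QuantumFieldTheory.Balaban1983to89.B13ScaleTransfer
open Summit.QuantumFields.BalabanUV.T4Continuum.ZoneSkeleton Summit.QuantumFields.BalabanUV.T4Continuum.HistorySocketTH
open Summit.QuantumFields.BalabanUV.T4Continuum.HistoryCaps Summit.QuantumFields.BalabanUV.T4Continuum.HistoryAssemblyPrice
open Summit.QuantumFields.BalabanUV.T4Continuum.HistoryBankingLE Summit.QuantumFields.BalabanUV.T4Continuum.HistoryExitLE
open Summit.QuantumFields.BalabanUV.T4Continuum.HistoryAssemblyTreesLE Summit.QuantumFields.BalabanUV.T4Continuum.HistoryAssemblyTermsLE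
open Summit.QuantumFields.BalabanUV.T4Continuum.HistoryRealise Summit.QuantumFields.BalabanUV.T4Continuum.HistoryAssemblyRealiseLE
open Summit.QuantumFields.BalabanUV.T4Continuum.HistoryAssemblyMult Summit.QuantumFields.BalabanUV.T4Continuum.HistoryAssemblyMultKey
open Summit.QuantumFields.BalabanUV.T4Continuum.HistoryAssemblyRealiseRun Summit.QuantumFields.BalabanUV.T4Continuum.HistoryAssemblyRealiseMult
open Summit.QuantumFields.BalabanUV.T4Continuum.HistoryZones Summit.QuantumFields.BalabanUV.T4Continuum.HistoryRealiseCells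
open Summit.QuantumFields.BalabanUV.T4Continuum.HistoryRealiseCellsRun Summit.QuantumFields.BalabanUV.T4Continuum.HistoryAssemblyRealiseRunMult
open Summit.QuantumFields.BalabanUV.T4Continuum.HistoryRealiseCellsRunMult Summit.QuantumFields.BalabanUV.T4Continuum.HistoryAssemblyMultInstance
open Summit.QuantumFields.BalabanUV.T4Continuum.HistoryJoinsPlacedMember Summit.QuantumFields.BalabanUV.T4Continuum.PlacementSkeleton
open Summit.QuantumFields.BalabanUV.T4Continuum.HistoryJoinsPlacedMult Summit.QuantumFields.BalabanUV.T4Continuum.HistoryRealiseDistinct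
open Summit.QuantumFields.BalabanUV.T4Continuum.HistoryRegionTemplates Summit.QuantumFields.BalabanUV.T4Continuum.HistoryCaps
open Summit.QuantumFields.BalabanUV.T4Continuum.HistoryZoneEvolve (cth)
open Literature.MathematicalPhysics.QuantumFieldTheory.Balaban1983to89.B16SProfile (DropCtl)
open Summit.QuantumFields.BalabanUV.T4Continuum.HistoryRealiseCellsRunMultEnd Summit.QuantumFields.BalabanUV.T4Continuum.HistoryRealiseCellsRunMultEndD
open Summit.QuantumFields.BalabanUV.T4Continuum.HistoryRealiseCellsRunPinnedT3b Summit.QuantumFields.BalabanUV.T4Continuum.HistoryHybridRescale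
open Summit.QuantumFields.BalabanUV.T4Continuum.HistoryRealiseCellsRunApex (exists_const_schemeZ)
open Summit.QuantumFields.BalabanUV.T4Continuum.HistoryRealisePrint Summit.QuantumFields.BalabanUV.T4Continuum.HistoryRealiseWeak
open Summit.QuantumFields.BalabanUV.T4Continuum.HistoryRealisePrintReading Summit.QuantumFields.BalabanUV.T4Continuum.HistoryRealiseWeakReading
open Summit.QuantumFields.BalabanUV.T4Continuum.HistoryRealisePrintCells Summit.QuantumFields.BalabanUV.T4Continuum.HistoryRealiseWeakCells
open Summit.QuantumFields.BalabanUV.T4Continuum.HistoryRealiseCellsRunApexT3b Summit.QuantumFields.BalabanUV.T4Continuum.HistoryRealiseCellsRunApexT3bW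
open Summit.QuantumFields.BalabanUV.T4Continuum.HistoryRealiseCellsRunApexT3bWT Summit.QuantumFields.BalabanUV.T4Continuum.HistoryRealiseCellsRunPinnedT3bWT
open Summit.QuantumFields.BalabanUV.T4Continuum.HistoryRealiseCellsRunHeadlineT3bWT
open Summit.QuantumFields.BalabanUV.T4Continuum.HistoryRealiseCellsRunApexT3bWTV Summit.QuantumFields.BalabanUV.T4Continuum.HistoryBankingVolumePlug
open Summit.QuantumFields.BalabanUV.T4Continuum.HistoryRealiseCellsRunApexT3bWTVS
open Summit.QuantumFields.BalabanUV.T4Continuum.HistoryGenealogyRealise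
open Summit.QuantumFields.BalabanUV.T4Continuum.HistoryGenealogyInstantiate
open Summit.QuantumFields.BalabanUV.T4Continuum.B16HistoryIndexedRepr
open Summit.QuantumFields.BalabanUV.T4Continuum.B16HistoryIndexedTrunc
open Summit.QuantumFields.BalabanUV.T4Continuum.HistoryBankingDiscountCharge
open Summit.QuantumFields.BalabanUV.T4Continuum.HistoryBankingCreditRead
open Summit.QuantumFields.BalabanUV.T4Continuum.HistoryBankingFibreRoom
open Summit.QuantumFields.BalabanUV.T4Continuum.HistoryPriceKeys
open Summit.QuantumFields.BalabanUV.T4Continuum.HistoryRealiseCellsRunSupplyWTVS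
open Summit.QuantumFields.BalabanUV.T4Continuum.HistoryRealiseCellsRunSupplyKeysWTVS
open Summit.QuantumFields.BalabanUV.T4Continuum.HistoryRealiseCellsRunAssemblyWTVSData
open Summit.QuantumFields.BalabanUV.T4Continuum.HistoryRealiseCellsRunAssemblyWTVSDataL
open Summit.QuantumFields.BalabanUV.T4Continuum.HistoryRealiseCellsRunAssemblyWTVSDataLW
open Summit.QuantumFields.BalabanUV.T4Continuum.HistoryRealiseCellsRunAssemblyWTVSL
open Summit.QuantumFields.BalabanUV.T4Continuum.HistoryRealiseCellsRunApexT3bWTVSL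
open Summit.QuantumFields.BalabanUV.T4Continuum.HistoryBankingSharpShares (sBsharp)
open Summit.QuantumFields.BalabanUV.T4Continuum.HistoryBankingRoundingSupply (ellStar)
open Summit.QuantumFields.BalabanUV.T4Continuum.HistoryBankingRoundingUnrounded (sRunr ApFlat)
open Summit.QuantumFields.BalabanUV.T4Continuum.HistoryBankingRoundingTuned
open Summit.QuantumFields.BalabanUV.T4Continuum.HistoryBankingVolumeWindow
open Summit.QuantumFields.BalabanUV.T4Continuum.HistoryBankingVolumeSupply
open Summit.QuantumFields.BalabanUV.T4Continuum.HistoryBankingForestVolume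
open Summit.QuantumFields.BalabanUV.T4Continuum.HistoryBankingForestPlug
open Summit.QuantumFields.BalabanUV.T4Continuum.HistoryBankingAnchors82
open Summit.QuantumFields.BalabanUV.T4Continuum.HistoryBankingShrunkLedger82
open Summit.QuantumFields.BalabanUV.T4Continuum.HistoryBankingShrunkWitness82
open Summit.QuantumFields.BalabanUV.T4Continuum.HistoryBankingVolumeWindowCollar
open Summit.QuantumFields.BalabanUV.T4Continuum.HistoryBankingVolumeWindowShrunk82
open Summit.QuantumFields.BalabanUV.T4Continuum.B16HistoryWeightPlugW
open Summit.QuantumFields.BalabanUV.T4Continuum.HistoryRealiseCellsRunSupplyWTVSW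
open Summit.QuantumFields.BalabanUV.T4Continuum.HistoryRealiseCellsRunAssemblyWTVSDataLP
open Summit.QuantumFields.BalabanUV.T4Continuum.HistoryRealiseCellsRunAssemblyWTVSLW
open Summit.QuantumFields.BalabanUV.T4Continuum.HistoryRealiseCellsRunAssemblyWTVSLP
open Summit.QuantumFields.BalabanUV.T4Continuum.HistoryBankingVolumeWindowLattice
open Summit.QuantumFields.BalabanUV.T4Continuum.HistoryRealiseCellsRunAssemblyWTVSLWP82
open Summit.QuantumFields.BalabanUV.T4Continuum.HistoryRealiseCellsRunAssemblyWTVSDataLWL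
open Literature.MathematicalPhysics.QuantumFieldTheory.Balaban1983to89.TreeLength Literature.MathematicalPhysics.QuantumFieldTheory.Balaban1983to89.B16MergeGeometry
open Summit.QuantumFields.BalabanUV.T4Continuum.HistoryAdmissible Summit.QuantumFields.BalabanUV.T4Continuum.HistoryGenealogyExtraction
open Summit.QuantumFields.BalabanUV.T4Continuum.HistoryGenealogyPedigree Summit.QuantumFields.BalabanUV.T4Continuum.HistoryTouchComponents
open Summit.QuantumFields.BalabanUV.T4Continuum.HistoryBankingSharpShares (ell)
open Summit.QuantumFields.BalabanUV.T4Continuum.HistoryBankingRoundingSupply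
open Summit.QuantumFields.BalabanUV.T4Continuum.B16HistoryReprChain Summit.QuantumFields.BalabanUV.T4Continuum.B16HistoryReprInstance
open Summit.QuantumFields.BalabanUV.T4Continuum.B16HistoryReprRead Summit.QuantumFields.BalabanUV.T4Continuum.B16HistoryReprReadCausal
open Summit.QuantumFields.BalabanUV.T4Continuum.B16HistoryStepDisplayPinned
open Summit.QuantumFields.BalabanUV.T4Continuum.HistoryRealiseCellsRunAssemblyWTVSLWLP82
open Summit.QuantumFields.BalabanUV.T4Continuum.B16HistoryTowerEndDataLWL Summit.QuantumFields.BalabanUV.T4Continuum.B16HistoryTowerEndDataLWR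
open Literature.MathematicalPhysics.QuantumFieldTheory.Balaban1983to89.B16StepFactorsPrinted
open Literature.MathematicalPhysics.QuantumFieldTheory.Balaban1983to89.B16LargeFieldFactors380 (minConst)
open T4PrintedShapeBanking T4Continuum
open Literature.MathematicalPhysics.QuantumFieldTheory.Balaban1983to89.TreeLength
open Literature.MathematicalPhysics.QuantumFieldTheory.Balaban1983to89.B16MergeGeometry
open Summit.QuantumFields.BalabanUV.T4Continuum.HistoryConstants
open Summit.QuantumFields.BalabanUV.T4Continuum.HistoryAdmissible
open Summit.QuantumFields.BalabanUV.T4Continuum.HistoryGenealogyExtraction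
open Summit.QuantumFields.BalabanUV.T4Continuum.B16HistoryReprChain
open Summit.QuantumFields.BalabanUV.T4Continuum.B16HistoryReprInstance
open Summit.QuantumFields.BalabanUV.T4Continuum.B16HistoryReprReadCausal
open Summit.QuantumFields.BalabanUV.T4Continuum.B16HistoryStepJunction
open Summit.QuantumFields.BalabanUV.T4Continuum.B16HistoryTowerEndDataLWL
open Summit.QuantumFields.BalabanUV.T4Continuum.B16HistoryTowerEndDataLWR
open Summit.QuantumFields.BalabanUV.T4Continuum.B16HistoryTowerEndPrinted
open Summit.QuantumFields.BalabanUV.T4Continuum.HistoryBankingVolumeWindowLattice (uvolL)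
open Summit.QuantumFields.BalabanUV.T4Continuum.B16HistoryTowerEndPrintedR
open Summit.QuantumFields.BalabanUV.T4Continuum.B16HistoryTowerEndLWRP82
open Summit.QuantumFields.BalabanUV.T4Continuum.B16HistoryTowerStepDataLWR

namespace Summit.QuantumFields.BalabanUV.T4Continuum.B16HistoryTowerStepLWRP82

noncomputable section

set_option synthInstance.maxSize 1024

/-! ## §1 The rounded tower record from the per-step record -/

section Embed

variable {F : T4Family} {G : Type*} [GaugeGroup G] [MeasurableSpace G] [HaarData G] [RegularGaugeGroup G]
  {D : FiniteEpsData F G} {C : T4PrintedShapeBanking.Consts} {O : PrintedO1s} {θv : ℝ} {rr d n : ℕ} {hn : 0 < n}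
  {g₀ : ℕ → ℝ} {os : List (ULoop F)} {cΛ M Φ β₀ : ℝ} {p₁ η η' κ κ₂ κᵥ : ℕ}
  {P : Type} [DecidableEq P] {X : ℕ → ℕ → Type} {𝒢 : (K j : ℕ) → GoodClass (X K j)}
  [∀ K, MeasurableSpace (X K K)] {μ : (K : ℕ) → Measure (X K K)} [∀ K, IsFiniteMeasure (μ K)]
  {DomK' : ℕ → Type} {I' : (K : ℕ) → HIndex (DomK' K)}
  {Y : ℕ → Type} [∀ K, MeasurableSpace (Y K)] {νB : (K : ℕ) → Measure (Y K)} [∀ K, IsFiniteMeasure (νB K)]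
  {𝒢' : (K : ℕ) → GoodClass (Y K)}

/-- **THE ROUNDED TOWER RECORD FROM THE PER-STEP RECORD** (IR-101-2's `toTowerR`): every field of `TowerReadDataLWR` BY NAME from `Sd`,
the birth letter `sB := B16HistoryStepJunction.sBsharp (runsOf D g₀) Sd.c`, the pinned display `hw` by 3R's
`hw_of_stepDisplays_rounded` (J4 ∘ J4.1 at the rounded renewal letter, ON THE NOSE under the tables `hd hR hP`) and the birth floor
`hsB` by part 3's `hsB_of_tables` (under `hγc hAc hpc hmc` and print's sign `0 < γ₀`).  No letter weakened or strengthened. [folklore] -/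
def _root_.Summit.QuantumFields.BalabanUV.T4Continuum.B16HistoryTowerStepDataLWR.TowerStepDataLWR.toTowerR
    (Sd : TowerStepDataLWR D C O θv rr d n hn g₀ os cΛ M Φ β₀ p₁ η η' κ κ₂ κᵥ P X 𝒢 μ I' Y νB 𝒢') :
    TowerReadDataLWR D C O θv rr d n hn g₀ os cΛ M Φ β₀ p₁ η η' κ κ₂ κᵥ P X 𝒢 μ I' Y νB 𝒢' :=
  { Sd with
    sB := B16HistoryStepJunction.sBsharp (runsOf D g₀) Sd.c
    hw := hw_of_stepDisplays_rounded D O p₁ g₀ Sd.T Sd.𝒮 Sd.c Sd.Xs cΛ M Sd.hcΛ Sd.hMΛ Sd.hℓ Sd.hdisp Sd.hclass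
      Sd.hchain Sd.hd Sd.hR Sd.hP
    hsB := fun K j d' => hsB_of_tables D g₀ O Sd.m C Sd.c Sd.hγc Sd.hAc Sd.hpc Sd.hγ₀.le Sd.hmc K j d' }

omit [RegularGaugeGroup G] in
/-- `toTowerR` pins: the tower, the small-field choices, the reading, the cutoff, the source radius and run B's truncation ARE the
per-step record's, and the birth letter IS print's sharp one (all `rfl`). [folklore] -/
theorem _root_.Summit.QuantumFields.BalabanUV.T4Continuum.B16HistoryTowerStepDataLWR.TowerStepDataLWR.toTowerR_data
    (Sd : TowerStepDataLWR D C O θv rr d n hn g₀ os cΛ M Φ β₀ p₁ η η' κ κ₂ κᵥ P X 𝒢 μ I' Y νB 𝒢') :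
    Sd.toTowerR.T = Sd.T ∧ Sd.toTowerR.p₀ = Sd.p₀ ∧ Sd.toTowerR.𝒮 = Sd.𝒮 ∧ Sd.toTowerR.K₀ = Sd.K₀ ∧ Sd.toTowerR.l₀ = Sd.l₀ ∧
      Sd.toTowerR.trunc = Sd.trunc ∧ Sd.toTowerR.sB = B16HistoryStepJunction.sBsharp (runsOf D g₀) Sd.c :=
  ⟨rfl, rfl, rfl, rfl, rfl, rfl, rfl⟩

omit [RegularGaugeGroup G] in
/-- `toTowerR`'s factor bundle IS the pinned bundle at print's sharp birth letter and the rounded renewal letter (`rfl`). [folklore] -/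
theorem _root_.Summit.QuantumFields.BalabanUV.T4Continuum.B16HistoryTowerStepDataLWR.TowerStepDataLWR.toTowerR_Φf
    (Sd : TowerStepDataLWR D C O θv rr d n hn g₀ os cΛ M Φ β₀ p₁ η η' κ κ₂ κᵥ P X 𝒢 μ I' Y νB 𝒢') :
    Sd.toTowerR.Φf = factorsPinned Sd.T Sd.p₀ Sd.𝒮 Sd.B (B16HistoryStepJunction.sBsharp (runsOf D g₀) Sd.c)
      (sRrnd D O p₁ g₀ Sd.𝒮.R) cΛ M (gsOf D g₀) Sd.hcΛ Sd.hMΛ Sd.hℓ :=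
  rfl

end Embed

/-! ## §2 The terminal theorem: the headline from SOME per-step tower record, for all small couplings -/

section SU

variable {F : T4Family} {N : ℕ} [NeZero N] {ℰ : LoopAverage (Matrix.specialUnitaryGroup (Fin N) ℂ)}

/-- **THE HEADLINE PREDICATE FROM A TOWER-FORM READING OF (1.72) CARRYING PRINT's PER-STEP SENTENCES AT THE TOWER's CARRIERS**:
`ContinuumYM4Torus D` for (0.4)-block-averaged data on `SU(N)` with a measurable small-loop average, GIVEN `(B)` and `BetaPertHyp` BY
NAME, the sign conventions, the `_fsc` family's constants-only side conditions, TEN window-threshold letters `cΛ M Φ b₀ p₁ η η′ κ κ₂ κᵥ`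
(bound here), and — for all small-coupling tuned runs and every loop string — SOME per-step tower record `TowerStepDataLWR …`.  Proof:
2R's `continuumYM4Torus_of_towerReadingLWR_fsc` ∘ `ForSmallCouplings.mono` ∘ §1 `toTowerR`.  CONDITIONAL on everything the record
displays ((A1c) = which tower and which carriers are Bałaban's); NE7b NOT proved; count 0∕9. [folklore] -/
theorem continuumYM4Torus_of_towerStepDisplays_fsc (D : FiniteEpsData F (Matrix.specialUnitaryGroup (Fin N) ℂ))
    (hBA : D.IsBlockAveraged ℰ) (hE : ℰ.MeasurableE)
    (hB : B16.EndStatementBPrinted D.C) (hβ : BetaPertHyp D.βfun) (hsign : B16.SignConventions D.C)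
    {C : T4PrintedShapeBanking.Consts} {O : PrintedO1s}
    {rr : ℕ} {β₀ : ℝ} (h : ThresholdOK C F.L rr β₀) (hμ : 0 < C.μ) (d n : ℕ)
    (hκ₁ : (d : ℝ) * Real.log F.L + 2 * Real.log 2 ≤ C.κ₁) (hE₀ : Real.log (2 + birthMass C) ≤ C.E₀)
    (hA₀ : 1 ≤ C.A₀) (hβ₀ : 0 < β₀) (hLβ : (F.L : ℝ) * β₀ ≤ 1) (hn₁ : 13 ≤ C.n₁) (hn : 0 < n)
    {θ θv : ℝ} (hθ : 0 < θ) (hslack : C.a + (θ + θv) ≤ O.γ₀ * O.A₁ ^ 2 / 2)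
    (hE₂ : 0 < C.E₂) (hE₃ : 0 ≤ C.E₃) {sS : ℕ} (hsS : 1 ≤ sS)
    (hsmall : (((2 * cth 32 1 sS + 1) ^ d : ℕ) : ℝ) * (5 : ℝ) ^ d * ((max 1 (2 * 32 + 2) : ℕ) : ℝ) ≤
      (F.L : ℝ) ^ (sS / 2) / 2)
    {θc : ℝ} (hθc0 : 0 ≤ θc) (hθc1 : θc < 1) (hθcs : 1 / 2 ≤ θc ^ sS)
    {cΛ M Φ b₀ : ℝ} {p₁ η η' κ κ₂ κᵥ : ℕ}
    (hRead : T4ContinuumYM4Torus.ForSmallCouplings D fun g₀ => ∀ os : List (ULoop F),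
        ∃ (P : Type) (_ : DecidableEq P) (X : ℕ → ℕ → Type) (𝒢 : (K j : ℕ) → GoodClass (X K j))
          (_ : ∀ K, MeasurableSpace (X K K)) (μ : (K : ℕ) → Measure (X K K)) (_ : ∀ K, IsFiniteMeasure (μ K))
          (DomK' : ℕ → Type) (I' : (K : ℕ) → HIndex (DomK' K))
          (Y : ℕ → Type) (_ : ∀ K, MeasurableSpace (Y K)) (νB : (K : ℕ) → Measure (Y K))
          (_ : ∀ K, IsFiniteMeasure (νB K)) (𝒢' : (K : ℕ) → GoodClass (Y K)),
          Nonempty (TowerStepDataLWR D C O θv rr d n hn g₀ os cΛ M Φ b₀ p₁ η η' κ κ₂ κᵥ P X 𝒢 μ I' Y νB 𝒢')) :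
    T4ContinuumYM4Torus.ContinuumYM4Torus D :=
  continuumYM4Torus_of_towerReadingLWR_fsc D hBA hE hB hβ hsign h hμ d n hκ₁ hE₀ hA₀ hβ₀ hLβ hn₁ hn hθ hslack hE₂ hE₃ hsS
    hsmall hθc0 hθc1 hθcs
    (hRead.mono fun g₀ hg os => by
      obtain ⟨P, iP, X, 𝒢, mX, μ, hμf, DomK', I', Y, mY, νB, hνf, 𝒢', ⟨Sd⟩⟩ := hg os
      exact ⟨P, iP, X, 𝒢, mX, μ, hμf, DomK', I', Y, mY, νB, hνf, 𝒢', ⟨Sd.toTowerR⟩⟩)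

end SU

end

end Summit.QuantumFields.BalabanUV.T4Continuum.B16HistoryTowerStepLWRP82
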